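import Mathlib.Algebra.MvPolynomial.Degrees
import Mathlib.Analysis.SpecialFunctions.Exp
import Mathlib.Analysis.SpecialFunctions.Pow.Real
import Literature.NumberTheory.Transcendental.BakerLogarithms
import Literature.NumberTheory.Transcendental.ChudnovskyHeights
import HarnessLib

/-!
# Diaz 1989, Théorème 1 — the construction (§II-2): the polynomials `P_{dλ}`, `Q_μ`, Siegel's step

Topic `Literature/NumberTheory/Transcendental` (trunk T-TRANSCEND). Decomposition step for the
named fact `Literature.NumberTheory.Transcendental.Diaz1989_thm1` (`DiazMain.lean`). This file formalises §II-2
("Premier pas : la construction", pp. 4–5) of G. Diaz, J. Number Theory 31 (1989).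

Setting (§II-1): `u₁,…,u_n`, `v₁,…,v_m ∈ ℂ`; the point
`θ = (v₁,…,v_m, e^{u₁v₁},…,e^{u_nv_m}) ∈ ℂ^{m+nm}`; variables `Y = (Y₁,…,Y_m, Y₁₁,…,Y_nm)` — here
`Var m n = Fin m ⊕ (Fin n × Fin m)`. The auxiliary function is `F(z) = P(z, e^{u₁z},…,e^{u_nz})`,
`P(W) = ∑_{d<D} ∑_{|λ|<L} p_{dλ} W₀^d W^λ`, `p_{dλ} = P_{dλ}(θ)`, `P_{dλ} ∈ ℤ[Y]` of degree `< D` in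
the `Y_k` and `< LM` in the `Y_hk`. For `μ ∈ ℕ^m`,
`Q_μ(Y) = ∑_{d,λ} P_{dλ}(Y) (∑_k μ_kY_k)^d ∏_{h,k} Y_hk^{λ_hμ_k} ∈ ℤ[Y]` (`R_{dλμ}` the cofactor), so
that `Q_μ(θ) = F(μ.v)` (`aeval_R`, `aeval_Q`). Siegel's lemma (here: Baker 1975, Lemma 1, as
proved in `BakerLogarithms.lean` from Mathlib) gives `P_{dλ}` not all zero with `Q_μ(Y) = 0`
identically for all `μ ∈ ℕ^m(M)`, as soon as (𝒞1) `2^{mn+m+1} M^m ≤ D Lⁿ`, with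
`log max H(P_{dλ}) ≤ c₁(D log M + log L)` — here with the explicit height bound
`#unknowns · (mM)^D` (`exists_coeffs`).

Contents: index types `DL`, `ExpIdx`, `Unk`; `toExp`, `Pdl`, `Rfac`, `Q`; the evaluation identities
`aeval_Rfac`, `aeval_Q`; degree bounds `degreeOf_Q_inl_lt`, `degreeOf_Q_inr_lt`; the `ℓ¹`-bound
`l1_Rfac_le`; and `exists_coeffs` (Siegel's step). Everything here is proved.

## References

* G. Diaz, *Grands degrés de transcendance pour des familles d'exponentielles*, J. Number Theory
  31 (1989), 1–23, §II-1, §II-2, pp. 4–5.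
* A. Baker, *Transcendental Number Theory* (1975), Ch. 2, Lemma 1 (Siegel's lemma).
-/

noncomputable section

open MvPolynomial Finset Finsupp Literature.NumberTheory.Transcendental.Chudnovsky

namespace Literature.NumberTheory.Transcendental

namespace DiazThm1

/-- The variables `Y = (Y₁,…,Y_m, Y₁₁,…,Y_nm)`: `inl k ↦ Y_k`, `inr (h,k) ↦ Y_hk`.
[cite: Diaz1989, §II-1 p. 4] -/
abbrev Var (m n : ℕ) : Type := Fin m ⊕ (Fin n × Fin m)

/-- The point `θ = (v₁,…,v_m, e^{u₁v₁},…,e^{u_nv_m})`. [cite: Diaz1989, §II-1 p. 4] -/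
def theta {m n : ℕ} (u : Fin n → ℂ) (v : Fin m → ℂ) : Var m n → ℂ :=
  Sum.elim v fun p => Complex.exp (u p.1 * v p.2)

/-- `θ` on `Y_k` is `v_k`. [folklore] -/
@[simp] theorem theta_inl {m n : ℕ} (u : Fin n → ℂ) (v : Fin m → ℂ) (k : Fin m) :
    theta u v (Sum.inl k) = v k := rfl

/-- `θ` on `Y_hk` is `e^{u_hv_k}`. [folklore] -/
@[simp] theorem theta_inr {m n : ℕ} (u : Fin n → ℂ) (v : Fin m → ℂ) (p : Fin n × Fin m) :
    theta u v (Sum.inr p) = Complex.exp (u p.1 * v p.2) := rfl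

/-- The indices `(d, λ)`, `0 ≤ d < D`, `λ ∈ ℕⁿ(L)`. [cite: Diaz1989, §II-2 p. 4] -/
abbrev DL (n D L : ℕ) : Type := Fin D × (Fin n → Fin L)

/-- The exponents of the monomials allowed in `P_{dλ}`: degree `< D` in each `Y_k`, `< LM` in each
`Y_hk`. [cite: Diaz1989, §II-2 p. 5] -/
abbrev ExpIdx (m n D L M : ℕ) : Type := (Fin m → Fin D) × (Fin n × Fin m → Fin (L * M))

/-- The unknowns of Siegel's system: the coefficients of all `P_{dλ}`. [cite: Diaz1989, §II-2 p. 5] -/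
abbrev Unk (m n D L M : ℕ) : Type := DL n D L × ExpIdx m n D L M

variable {m n D L M : ℕ}

/-- The exponent vector of an `ExpIdx`. [folklore] -/
def toExp (ε : ExpIdx m n D L M) : Var m n →₀ ℕ :=
  equivFunOnFinite.symm (Sum.elim (fun k => (ε.1 k : ℕ)) fun p => (ε.2 p : ℕ))

/-- `toExp` on `Y_k`. [folklore] -/
@[simp] theorem toExp_inl (ε : ExpIdx m n D L M) (k : Fin m) : toExp ε (Sum.inl k) = ε.1 k := rfl

/-- `toExp` on `Y_hk`. [folklore] -/
@[simp] theorem toExp_inr (ε : ExpIdx m n D L M) (p : Fin n × Fin m) :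
    toExp ε (Sum.inr p) = ε.2 p := rfl

/-- `toExp` is injective. [folklore] -/
theorem toExp_injective : Function.Injective (toExp : ExpIdx m n D L M → Var m n →₀ ℕ) := by
  rintro ⟨a, b⟩ ⟨a', b'⟩ h
  have h1 : a = a' := funext fun k => Fin.ext (by simpa using congrArg (fun f => f (Sum.inl k)) h)
  have h2 : b = b' := funext fun p => Fin.ext (by simpa using congrArg (fun f => f (Sum.inr p)) h)
  rw [h1, h2]

/-- `P_{dλ}(Y) = ∑_ε p_{(dλ),ε} Y^ε`. [cite: Diaz1989, §II-2 p. 5] -/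
def Pdl (p : Unk m n D L M → ℤ) (a : DL n D L) : MvPolynomial (Var m n) ℤ :=
  ∑ ε : ExpIdx m n D L M, monomial (toExp ε) (p (a, ε))

/-- The coefficient of `Y^{ε}` in `P_{dλ}` is the unknown `p_{(dλ),ε}`. [folklore] -/
theorem coeff_toExp_Pdl (p : Unk m n D L M → ℤ) (a : DL n D L) (ε : ExpIdx m n D L M) :
    coeff (toExp ε) (Pdl p a) = p (a, ε) := by
  classical
  unfold Pdl
  rw [coeff_sum, Finset.sum_eq_single ε]
  · rw [coeff_monomial, if_pos rfl]
  · intro ε' _ hne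
    rw [coeff_monomial, if_neg fun h => hne (toExp_injective h)]
  · intro h
    exact absurd (Finset.mem_univ ε) h

/-- If all `P_{dλ}` vanish then all unknowns vanish. [folklore] -/
theorem eq_zero_of_Pdl_eq_zero {p : Unk m n D L M → ℤ} (h : ∀ a, Pdl p a = 0) : p = 0 := by
  funext ⟨a, ε⟩
  have := coeff_toExp_Pdl p a ε
  rw [h a, coeff_zero] at this
  exact this.symm

/-- The exponent vector `(0,…,0 ; λ_hμ_k)` of `∏ Y_hk^{λ_hμ_k}`. [folklore] -/
def lamMu (lam : Fin n → Fin L) (μ : Fin m → ℕ) : Var m n →₀ ℕ :=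
  equivFunOnFinite.symm (Sum.elim (fun _ => 0) fun p => (lam p.1 : ℕ) * μ p.2)

/-- `lamMu` vanishes on `Y_k`. [folklore] -/
@[simp] theorem lamMu_inl (lam : Fin n → Fin L) (μ : Fin m → ℕ) (k : Fin m) :
    lamMu lam μ (Sum.inl k) = 0 := rfl

/-- `lamMu` on `Y_hk` is `λ_hμ_k`. [folklore] -/
@[simp] theorem lamMu_inr (lam : Fin n → Fin L) (μ : Fin m → ℕ) (p : Fin n × Fin m) :
    lamMu lam μ (Sum.inr p) = (lam p.1 : ℕ) * μ p.2 := rfl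

/-- The linear form `∑_k μ_k Y_k`. [folklore] -/
def linForm (m n : ℕ) (μ : Fin m → ℕ) : MvPolynomial (Var m n) ℤ :=
  ∑ k : Fin m, C (μ k : ℤ) * X (Sum.inl k)

/-- The cofactor `R_{dλμ}(Y) = (∑_k μ_kY_k)^d ∏_{h,k} Y_hk^{λ_hμ_k}`. [cite: Diaz1989, §II-2 p. 5] -/
def Rfac (a : DL n D L) (μ : Fin m → ℕ) : MvPolynomial (Var m n) ℤ :=
  linForm m n μ ^ (a.1 : ℕ) * monomial (lamMu a.2 μ) 1

/-- `Q_μ(Y) = ∑_{d,λ} P_{dλ}(Y) R_{dλμ}(Y)`. [cite: Diaz1989, §II-2 p. 5] -/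
def Q (p : Unk m n D L M → ℤ) (μ : Fin m → ℕ) : MvPolynomial (Var m n) ℤ :=
  ∑ a : DL n D L, Pdl p a * Rfac a μ

/-! ### Evaluation at `θ` -/

/-- `μ.v`. [folklore] -/
def muv (v : Fin m → ℂ) (μ : Fin m → ℕ) : ℂ := ∑ k, (μ k : ℂ) * v k

/-- `λ.u`. [folklore] -/
def lamu (u : Fin n → ℂ) (lam : Fin n → Fin L) : ℂ := ∑ h, ((lam h : ℕ) : ℂ) * u h

/-- `(∑ μ_kY_k)(θ) = μ.v`. [folklore] -/
theorem aeval_linForm (u : Fin n → ℂ) (v : Fin m → ℂ) (μ : Fin m → ℕ) :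
    aeval (theta u v) (linForm m n μ) = muv v μ := by
  simp [linForm, muv, map_sum]

/-- `(∏ Y_hk^{λ_hμ_k})(θ) = e^{(λ.u)(μ.v)}`. [folklore] -/
theorem aeval_monomial_lamMu (u : Fin n → ℂ) (v : Fin m → ℂ) (lam : Fin n → Fin L)
    (μ : Fin m → ℕ) :
    aeval (theta u v) (monomial (lamMu lam μ) (1 : ℤ)) = Complex.exp (lamu u lam * muv v μ) := by
  classical
  rw [aeval_monomial, map_one, one_mul, Finsupp.prod_fintype _ _ (fun i => by simp)]
  rw [Fintype.prod_sum_type]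
  simp only [theta_inl, lamMu_inl, pow_zero, Finset.prod_const_one, one_mul, theta_inr, lamMu_inr]
  have hx : ∀ x : Fin n × Fin m, Complex.exp (u x.1 * v x.2) ^ ((lam x.1 : ℕ) * μ x.2) =
      Complex.exp ((((lam x.1 : ℕ) * μ x.2 : ℕ) : ℂ) * (u x.1 * v x.2)) := fun x =>
    (Complex.exp_nat_mul _ _).symm
  simp_rw [hx]
  rw [← Complex.exp_sum]
  congr 1
  rw [lamu, muv, Finset.sum_mul_sum, Fintype.sum_prod_type]
  refine Finset.sum_congr rfl fun h _ => Finset.sum_congr rfl fun k _ => ?_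
  push_cast
  ring

/-- **`R_{dλμ}(θ) = (μ.v)^d e^{(λ.u)(μ.v)}`** (Diaz 1989, p. 8). [cite: Diaz1989, §II-3-2 (a) p. 8] -/
theorem aeval_Rfac (u : Fin n → ℂ) (v : Fin m → ℂ) (a : DL n D L) (μ : Fin m → ℕ) :
    aeval (theta u v) (Rfac a μ) = muv v μ ^ (a.1 : ℕ) * Complex.exp (lamu u a.2 * muv v μ) := by
  rw [Rfac, map_mul, map_pow, aeval_linForm, aeval_monomial_lamMu]

/-- **`Q_μ(θ) = F(μ.v)`** with `F(z) = ∑_{d,λ} P_{dλ}(θ) z^d e^{(λ.u) z}` (Diaz 1989, p. 5).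
[cite: Diaz1989, §II-2 p. 5] -/
theorem aeval_Q (u : Fin n → ℂ) (v : Fin m → ℂ) (p : Unk m n D L M → ℤ) (μ : Fin m → ℕ) :
    aeval (theta u v) (Q p μ) = ∑ a : DL n D L,
      aeval (theta u v) (Pdl p a) * (muv v μ ^ (a.1 : ℕ) * Complex.exp (lamu u a.2 * muv v μ)) := by
  simp only [Q, map_sum, map_mul, aeval_Rfac]

/-! ### Degrees -/

/-- Partial degrees of `P_{dλ}`: `< D` in `Y_k`. [cite: Diaz1989, §II-2 p. 5] -/
theorem degreeOf_Pdl_inl_le (p : Unk m n D L M → ℤ) (a : DL n D L) (k : Fin m) :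
    degreeOf (Sum.inl k) (Pdl p a) ≤ D - 1 := by
  classical
  unfold Pdl
  refine (degreeOf_sum_le _ _ _).trans (Finset.sup_le fun ε _ => ?_)
  rw [degreeOf_le_iff]
  intro e he
  have : e = toExp ε := by
    have := support_monomial_subset he
    simpa using this
  subst this
  simp only [toExp_inl]
  have := (ε.1 k).isLt
  omega

/-- Partial degrees of `P_{dλ}`: `< LM` in `Y_hk`. [cite: Diaz1989, §II-2 p. 5] -/
theorem degreeOf_Pdl_inr_le (p : Unk m n D L M → ℤ) (a : DL n D L) (q : Fin n × Fin m) :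
    degreeOf (Sum.inr q) (Pdl p a) ≤ L * M - 1 := by
  classical
  unfold Pdl
  refine (degreeOf_sum_le _ _ _).trans (Finset.sup_le fun ε _ => ?_)
  rw [degreeOf_le_iff]
  intro e he
  have : e = toExp ε := by
    have := support_monomial_subset he
    simpa using this
  subst this
  simp only [toExp_inr]
  have := (ε.2 q).isLt
  omega

/-- Total degree of `P_{dλ}`: `≤ m(D-1) + nm(LM-1) < mD + nmLM` (Diaz 1989, (2)).
[cite: Diaz1989, §II-3-2 (2) p. 8] -/
theorem totalDegree_Pdl_le (p : Unk m n D L M → ℤ) (a : DL n D L) :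
    (Pdl p a).totalDegree ≤ m * (D - 1) + n * m * (L * M - 1) := by
  classical
  unfold Pdl
  refine totalDegree_finsetSum_le fun ε _ => (totalDegree_monomial_le _ _).trans ?_
  rw [Finsupp.sum_fintype _ _ (fun _ => rfl), Fintype.sum_sum_type]
  simp only [id_eq, toExp_inl, toExp_inr]
  have h1 : ∑ k : Fin m, ((ε.1 k : ℕ)) ≤ m * (D - 1) := by
    calc ∑ k : Fin m, ((ε.1 k : ℕ)) ≤ ∑ _k : Fin m, (D - 1) :=
          Finset.sum_le_sum fun k _ => by have := (ε.1 k).isLt; omega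
      _ = m * (D - 1) := by simp
  have h2 : ∑ q : Fin n × Fin m, ((ε.2 q : ℕ)) ≤ n * m * (L * M - 1) := by
    calc ∑ q : Fin n × Fin m, ((ε.2 q : ℕ)) ≤ ∑ _q : Fin n × Fin m, (L * M - 1) :=
          Finset.sum_le_sum fun q _ => by have := (ε.2 q).isLt; omega
      _ = n * m * (L * M - 1) := by simp [Fintype.card_prod]
  omega

/-- Degree of the linear form in `Y_k`: `≤ 1`; in `Y_hk`: `0`. [folklore] -/
theorem degreeOf_linForm_le (μ : Fin m → ℕ) (x : Var m n) :
    degreeOf x (linForm m n μ) ≤ (match x with | Sum.inl _ => 1 | Sum.inr _ => 0) := by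
  classical
  unfold linForm
  refine (degreeOf_sum_le _ _ _).trans (Finset.sup_le fun k _ => ?_)
  refine (degreeOf_C_mul_le _ _ _).trans ?_
  rw [degreeOf_le_iff]
  intro e he
  rw [support_X, Finset.mem_singleton] at he
  subst he
  cases x with
  | inl k' =>
    simp only [Finsupp.single_apply]
    split_ifs <;> omega
  | inr q => simp

/-- Partial degrees of `R_{dλμ}`: `≤ d` in `Y_k`. [folklore] -/
theorem degreeOf_Rfac_inl_le (a : DL n D L) (μ : Fin m → ℕ) (k : Fin m) :
    degreeOf (Sum.inl k) (Rfac a μ) ≤ D - 1 := by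
  classical
  unfold Rfac
  refine (degreeOf_mul_le _ _ _).trans ?_
  have h1 : degreeOf (Sum.inl k) (linForm m n μ ^ (a.1 : ℕ)) ≤ D - 1 := by
    refine (degreeOf_pow_le _ _ _).trans ?_
    have := degreeOf_linForm_le (m := m) (n := n) μ (Sum.inl k)
    simp only at this
    have hd := a.1.isLt
    calc (a.1 : ℕ) * degreeOf (Sum.inl k) (linForm m n μ) ≤ (a.1 : ℕ) * 1 :=
          Nat.mul_le_mul_left _ this
      _ ≤ D - 1 := by omega
  have h2 : degreeOf (Sum.inl k) (monomial (lamMu a.2 μ) (1 : ℤ)) = 0 := by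
    rw [← Nat.le_zero, degreeOf_le_iff]
    intro e he
    have : e = lamMu a.2 μ := by
      have := support_monomial_subset he
      simpa using this
    subst this
    simp
  omega

/-- Partial degrees of `R_{dλμ}`: `≤ λ_hμ_k ≤ (L-1)(M-1)` in `Y_hk` for `μ ∈ ℕ^m(M)`. [folklore] -/
theorem degreeOf_Rfac_inr_le (a : DL n D L) {μ : Fin m → ℕ} (hμ : ∀ k, μ k < M)
    (q : Fin n × Fin m) : degreeOf (Sum.inr q) (Rfac a μ) ≤ (L - 1) * (M - 1) := by
  classical
  unfold Rfac
  refine (degreeOf_mul_le _ _ _).trans ?_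
  have h1 : degreeOf (Sum.inr q) (linForm m n μ ^ (a.1 : ℕ)) = 0 := by
    rw [← Nat.le_zero]
    refine (degreeOf_pow_le _ _ _).trans ?_
    have := degreeOf_linForm_le (m := m) (n := n) μ (Sum.inr q)
    simp only [Nat.le_zero] at this
    simp [this]
  have h2 : degreeOf (Sum.inr q) (monomial (lamMu a.2 μ) (1 : ℤ)) ≤ (L - 1) * (M - 1) := by
    rw [degreeOf_le_iff]
    intro e he
    have : e = lamMu a.2 μ := by
      have := support_monomial_subset he
      simpa using this
    subst this
    simp only [lamMu_inr]
    have hl := (a.2 q.1).isLt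
    have hm := hμ q.2
    exact Nat.mul_le_mul (by omega) (by omega)
  omega

/-- **Partial degrees of `Q_μ`**: `< 2D` in `Y_k`. [folklore] -/
theorem degreeOf_Q_inl_lt (p : Unk m n D L M → ℤ) (μ : Fin m → ℕ) (k : Fin m) (hD : 1 ≤ D) :
    degreeOf (Sum.inl k) (Q p μ) < 2 * D := by
  classical
  unfold Q
  refine lt_of_le_of_lt ((degreeOf_sum_le _ _ _).trans (Finset.sup_le fun a _ =>
    (degreeOf_mul_le _ _ _).trans (Nat.add_le_add (degreeOf_Pdl_inl_le p a k)
      (degreeOf_Rfac_inl_le a μ k)))) ?_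
  omega

/-- **Partial degrees of `Q_μ`**: `< 2LM` in `Y_hk`, for `μ ∈ ℕ^m(M)`. [folklore] -/
theorem degreeOf_Q_inr_lt (p : Unk m n D L M → ℤ) {μ : Fin m → ℕ} (hμ : ∀ k, μ k < M)
    (q : Fin n × Fin m) (hL : 1 ≤ L) (hM : 1 ≤ M) :
    degreeOf (Sum.inr q) (Q p μ) < 2 * (L * M) := by
  classical
  unfold Q
  refine lt_of_le_of_lt ((degreeOf_sum_le _ _ _).trans (Finset.sup_le fun a _ =>
    (degreeOf_mul_le _ _ _).trans (Nat.add_le_add (degreeOf_Pdl_inr_le p a q)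
      (degreeOf_Rfac_inr_le a hμ q)))) ?_
  have h1 : (L - 1) * (M - 1) < L * M := by
    calc (L - 1) * (M - 1) ≤ (L - 1) * M := Nat.mul_le_mul_left _ (Nat.sub_le _ _)
      _ < L * M := Nat.mul_lt_mul_of_pos_right (by omega) (by omega)
  have h2 : 1 ≤ L * M := Nat.one_le_iff_ne_zero.mpr (Nat.mul_ne_zero (by omega) (by omega))
  omega

/-! ### `ℓ¹`-norms -/

/-- `L(∑ μ_kY_k) ≤ ∑ μ_k`. [folklore] -/
theorem l1_linForm_le (μ : Fin m → ℕ) : l1 (linForm m n μ) ≤ ∑ k, (μ k : ℝ) := by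
  unfold linForm
  refine (wnorm_sum_le _ _ _).trans (Finset.sum_le_sum fun k _ => ?_)
  refine (wnorm_mul_le _ _ _).trans ?_
  rw [wnorm_C, wnorm_X, normRingSeminorm_int_one, mul_one, normRingSeminorm_int_apply]
  simp

/-- **`L(R_{dλμ}) ≤ (mM)^D`** for `μ ∈ ℕ^m(M)`, `m ≥ 1` (the bound for the entries of Siegel's
system; Diaz 1989, p. 9: `H(R_{dλμ}) ≤ (mM)^D`). [cite: Diaz1989, §II-3-2 (b) p. 9] -/
theorem l1_Rfac_le (hm : 1 ≤ m) (a : DL n D L) {μ : Fin m → ℕ} (hμ : ∀ k, μ k < M) :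
    l1 (Rfac a μ) ≤ ((m : ℝ) * M) ^ D := by
  have h1 : normRingSeminorm ℤ 1 ≤ 1 := by simp
  have hM : 1 ≤ M := by have := hμ ⟨0, hm⟩; omega
  have hmM : (1 : ℝ) ≤ (m : ℝ) * M := by
    have : (1 : ℕ) ≤ m * M := Nat.one_le_iff_ne_zero.mpr (Nat.mul_ne_zero (by omega) (by omega))
    exact_mod_cast this
  have hlin : l1 (linForm m n μ) ≤ (m : ℝ) * M := by
    refine (l1_linForm_le μ).trans ?_
    calc ∑ k, (μ k : ℝ) ≤ ∑ _k : Fin m, (M : ℝ) :=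
          Finset.sum_le_sum fun k _ => by exact_mod_cast (hμ k).le
      _ = m * M := by simp
  unfold Rfac
  refine (wnorm_mul_le _ _ _).trans ?_
  rw [wnorm_monomial, normRingSeminorm_int_one, mul_one]
  refine (wnorm_pow_le _ h1 _ _).trans ?_
  calc l1 (linForm m n μ) ^ (a.1 : ℕ) ≤ ((m : ℝ) * M) ^ (a.1 : ℕ) :=
        pow_le_pow_left₀ (wnorm_nonneg _ _) hlin _
    _ ≤ ((m : ℝ) * M) ^ D := pow_le_pow_right₀ hmM a.1.isLt.le

/-! ### Siegel's step (Diaz 1989, §II-2, "La construction") -/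

/-- Exponents bounding the monomials of `Q_μ`: `< 2D` in `Y_k`, `< 2LM` in `Y_hk`. [folklore] -/
abbrev ExpIdx2 (m n D L M : ℕ) : Type := (Fin m → Fin (2 * D)) × (Fin n × Fin m → Fin (2 * (L * M)))

/-- The equations of Siegel's system: `μ ∈ ℕ^m(M)` and a monomial of `Q_μ`. [folklore] -/
abbrev EqIdx (m n D L M : ℕ) : Type := (Fin m → Fin M) × ExpIdx2 m n D L M

/-- The exponent vector of an `ExpIdx2`. [folklore] -/
def toExp2 (e : ExpIdx2 m n D L M) : Var m n →₀ ℕ :=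
  equivFunOnFinite.symm (Sum.elim (fun k => (e.1 k : ℕ)) fun p => (e.2 p : ℕ))

/-- `toExp2` on `Y_k`. [folklore] -/
@[simp] theorem toExp2_inl (e : ExpIdx2 m n D L M) (k : Fin m) : toExp2 e (Sum.inl k) = e.1 k := rfl

/-- `toExp2` on `Y_hk`. [folklore] -/
@[simp] theorem toExp2_inr (e : ExpIdx2 m n D L M) (p : Fin n × Fin m) :
    toExp2 e (Sum.inr p) = e.2 p := rfl

/-- The integer point `μ ∈ ℕ^m(M)` of an equation index. [folklore] -/
def muOf (μ : Fin m → Fin M) : Fin m → ℕ := fun k => (μ k : ℕ)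

/-- `muOf μ ∈ ℕ^m(M)`. [folklore] -/
theorem muOf_lt (μ : Fin m → Fin M) (k : Fin m) : muOf μ k < M := (μ k).isLt

/-- The matrix of Siegel's system: the coefficient of `Y^{e}` in `Y^{ε} R_{dλμ}`. [folklore] -/
def mat (i : EqIdx m n D L M) (w : Unk m n D L M) : ℤ :=
  coeff (toExp2 i.2) (monomial (toExp w.2) 1 * Rfac w.1 (muOf i.1))

/-- The coefficients of `Q_μ` are the values of the linear forms of the system. [folklore] -/
theorem coeff_Q (p : Unk m n D L M → ℤ) (μ : Fin m → ℕ) (e : Var m n →₀ ℕ) :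
    coeff e (Q p μ) = ∑ w : Unk m n D L M, p w * coeff e (monomial (toExp w.2) 1 * Rfac w.1 μ) := by
  classical
  unfold Q Pdl
  rw [coeff_sum, Fintype.sum_prod_type (fun w : Unk m n D L M =>
    p w * coeff e (monomial (toExp w.2) 1 * Rfac w.1 μ))]
  refine Finset.sum_congr rfl fun a _ => ?_
  rw [Finset.sum_mul, coeff_sum]
  refine Finset.sum_congr rfl fun ε _ => ?_
  rw [show monomial (toExp ε) (p (a, ε)) = C (p (a, ε)) * monomial (toExp ε) 1 by
    rw [C_mul_monomial, mul_one], mul_assoc, coeff_C_mul]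

/-- Entries of the system are bounded by `(mM)^D`. [cite: Diaz1989, §II-2 p. 5 (height bound (1))] -/
theorem abs_mat_le (hm : 1 ≤ m) (i : EqIdx m n D L M) (w : Unk m n D L M) :
    |(mat i w : ℝ)| ≤ ((m : ℝ) * M) ^ D := by
  have h1 : normRingSeminorm ℤ 1 ≤ 1 := by simp
  unfold mat
  calc |((coeff (toExp2 i.2) (monomial (toExp w.2) 1 * Rfac w.1 (muOf i.1)) : ℤ) : ℝ)|
      = normRingSeminorm ℤ (coeff (toExp2 i.2) (monomial (toExp w.2) 1 * Rfac w.1 (muOf i.1))) := by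
        rw [normRingSeminorm_int_apply]
    _ ≤ l1 (monomial (toExp w.2) (1 : ℤ) * Rfac w.1 (muOf i.1)) := le_wnorm _ _ _
    _ ≤ l1 (monomial (toExp w.2) (1 : ℤ)) * l1 (Rfac w.1 (muOf i.1)) := wnorm_mul_le _ _ _
    _ ≤ 1 * ((m : ℝ) * M) ^ D := by
        refine mul_le_mul ?_ (l1_Rfac_le hm w.1 (muOf_lt i.1)) (wnorm_nonneg _ _) zero_le_one
        rw [l1, wnorm_monomial, normRingSeminorm_int_one]
    _ = ((m : ℝ) * M) ^ D := one_mul _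

/-- Cardinalities: `#Unk = D Lⁿ D^m (LM)^{nm}`. [folklore] -/
theorem card_Unk : Fintype.card (Unk m n D L M) = D * L ^ n * (D ^ m * (L * M) ^ (n * m)) := by
  simp only [Fintype.card_prod, Fintype.card_fin, Fintype.card_pi, Finset.prod_const,
    Finset.card_univ, Fintype.card_prod]

/-- Cardinalities: `#EqIdx = M^m (2D)^m (2LM)^{nm}`. [folklore] -/
theorem card_EqIdx : Fintype.card (EqIdx m n D L M) =
    M ^ m * ((2 * D) ^ m * (2 * (L * M)) ^ (n * m)) := by
  simp only [Fintype.card_prod, Fintype.card_fin, Fintype.card_pi, Finset.prod_const,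
    Finset.card_univ, Fintype.card_prod]

/-- Under (𝒞1) `2^{mn+m+1} M^m ≤ D Lⁿ` there are at least twice as many unknowns as equations.
[cite: Diaz1989, §II-2 (𝒞1) p. 5] -/
theorem two_mul_card_EqIdx_le (hC1 : 2 ^ (m + n * m + 1) * M ^ m ≤ D * L ^ n) :
    2 * Fintype.card (EqIdx m n D L M) ≤ Fintype.card (Unk m n D L M) := by
  rw [card_Unk, card_EqIdx]
  have e1 : 2 * (M ^ m * ((2 * D) ^ m * (2 * (L * M)) ^ (n * m))) =
      (2 ^ (m + n * m + 1) * M ^ m) * (D ^ m * (L * M) ^ (n * m)) := by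
    rw [mul_pow, mul_pow, pow_add, pow_add, pow_one]
    ring
  rw [e1]
  exact Nat.mul_le_mul_right _ hC1

/-- **Siegel's step** (Diaz 1989, §II-2, p. 5): if `m, D, L, M ≥ 1` and (𝒞1)
`2^{mn+m+1} M^m ≤ D Lⁿ`, there are integers `p_{(dλ),ε}`, not all zero, of absolute value at most
`#Unk · (mM)^D`, such that `Q_μ(Y) = 0` identically for every `μ ∈ ℕ^m(M)` (so the `P_{dλ}` are
not all zero, `eq_zero_of_Pdl_eq_zero`). [cite: Diaz1989, §II-2 p. 5 (Lemme de Siegel, (𝒞1), (1))] -/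
theorem exists_coeffs (hm : 1 ≤ m) (hD : 1 ≤ D) (hL : 1 ≤ L) (hM : 1 ≤ M)
    (hC1 : 2 ^ (m + n * m + 1) * M ^ m ≤ D * L ^ n) :
    ∃ p : Unk m n D L M → ℤ, p ≠ 0 ∧
      (∀ w, |(p w : ℝ)| ≤ (Fintype.card (Unk m n D L M) : ℝ) * ((m : ℝ) * M) ^ D) ∧
      ∀ μ : Fin m → ℕ, (∀ k, μ k < M) → Q p μ = 0 := by
  classical
  set NE := Fintype.card (EqIdx m n D L M) with hNE
  set NU := Fintype.card (Unk m n D L M) with hNU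
  have h2 : 2 * NE ≤ NU := two_mul_card_EqIdx_le hC1
  have hNEpos : 0 < NE := by
    rw [hNE, card_EqIdx]
    positivity
  have hlt : NE < NU := by omega
  set eE := Fintype.equivFin (EqIdx m n D L M)
  set eU := Fintype.equivFin (Unk m n D L M)
  set U : ℝ := ((m : ℝ) * M) ^ D with hU
  have hmM : (1 : ℝ) ≤ (m : ℝ) * M := by
    have : (1 : ℕ) ≤ m * M := Nat.one_le_iff_ne_zero.mpr (Nat.mul_ne_zero (by omega) (by omega))
    exact_mod_cast this
  have hU1 : 1 ≤ U := one_le_pow₀ hmM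
  obtain ⟨x, hx0, hxb, hxe⟩ := Literature.NumberTheory.Transcendental.Baker1975.lemma1 hNEpos hlt hU1
    (fun i j => mat (eE.symm i) (eU.symm j)) (fun i j => abs_mat_le hm _ _)
  refine ⟨fun w => x (eU w), ?_, ?_, ?_⟩
  · intro h0
    apply hx0
    funext j
    have := congrFun h0 (eU.symm j)
    simpa using this
  · intro w
    refine (hxb (eU w)).trans ?_
    have hbase : (1 : ℝ) ≤ NU * U := by
      have : (1 : ℝ) ≤ NU := by exact_mod_cast (show 1 ≤ NU by omega)
      nlinarith
    have hexp1 : (NE : ℝ) / (NU - NE) ≤ 1 := by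
      rw [div_le_one] <;> [skip; skip]
      · have : ((2 * NE : ℕ) : ℝ) ≤ NU := by exact_mod_cast h2
        push_cast at this
        linarith
      · have : ((NE : ℕ) : ℝ) < NU := by exact_mod_cast hlt
        linarith
    calc ((NU : ℝ) * U) ^ ((NE : ℝ) / (NU - NE)) ≤ ((NU : ℝ) * U) ^ (1 : ℝ) :=
          Real.rpow_le_rpow_of_exponent_le hbase hexp1
      _ = NU * U := Real.rpow_one _
  · intro μ hμ
    ext e
    rw [coeff_zero]
    by_cases hsmall : (∀ k, e (Sum.inl k) < 2 * D) ∧ ∀ q, e (Sum.inr q) < 2 * (L * M)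
    · -- an equation of the system
      set μ' : Fin m → Fin M := fun k => ⟨μ k, hμ k⟩
      set e' : ExpIdx2 m n D L M := (fun k => ⟨e (Sum.inl k), hsmall.1 k⟩,
        fun q => ⟨e (Sum.inr q), hsmall.2 q⟩)
      have hee : e = toExp2 e' := by
        ext x
        cases x with
        | inl k => rfl
        | inr q => rfl
      have hμμ : μ = muOf μ' := rfl
      rw [coeff_Q, hee, hμμ]
      have := hxe (eE (μ', e'))
      simp only [Equiv.symm_apply_apply] at this
      rw [← Equiv.sum_comp eU.symm (fun w : Unk m n D L M =>
        x (eU w) * coeff (toExp2 e') (monomial (toExp w.2) 1 * Rfac w.1 (muOf μ')))]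
      rw [← this]
      refine Finset.sum_congr rfl fun j _ => ?_
      simp only [Equiv.apply_symm_apply, mat]
      ring
    · -- not a monomial of `Q_μ`
      have hnot : e ∉ (Q (fun w => x (eU w)) μ).support := by
        intro he
        apply hsmall
        refine ⟨fun k => ?_, fun q => ?_⟩
        · exact (degreeOf_lt_iff (by omega)).mp (degreeOf_Q_inl_lt _ μ k hD) e he
        · have h2LM : 0 < 2 * (L * M) := by positivity
          exact (degreeOf_lt_iff h2LM).mp (degreeOf_Q_inr_lt _ hμ q hL hM) e he
      exact MvPolynomial.notMem_support_iff.mp hnot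

end DiazThm1


end Literature.NumberTheory.Transcendental

end
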